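import Mathlib
import Literature.Probability.LatticeModels.BalabanStepOneFormat
import Summits.HubbardSuperconductivity.HubbardSuperconductivity.Theorems.BalabanIRBirGappedPhaseReductionStructural
import HarnessLib

/-!
# Route BalabanIR — crux 4R `BirGappedPhaseReductionR` (item `stmt-HubbardSuperconductivity-14846`): the FORMAT PAIR closes it (split glue, structural)

Crux-strategist decomposition of the inert reduction `4R := 2R → 3 → X_avg` (with crux 3 proved,
`4R ↔ (2R → X_avg)`, `Theorems.birGappedPhaseReductionR_iff_engineR_imp_target`; the typed antecedent
`BirComplexStableXYR` exports nothing a Hubbard dictionary can consume: `Negative.NoExactFiniteTable`,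
`Negative.StripZeroFree`, `Negative.EngineThresholdScaling`) into the HONEST PAIR over the Defs layer
`Literature.Probability.LatticeModels.BalabanStepOne.StepOneFormat` (Balaban's depth-one small-field-action / large-field-activity format):

* child 1 `BirFormatEngine` (= 14845′, the engine RESTATED over weights in step-one format): for every
  budget `B`, coercivity rate `c₀ > 0` and large-field rate `cL > 0` there are a decay threshold `κ₀`,
  a stiffness threshold `K₀` and a size threshold `L₀` such that every weight `ρ` in
  `StepOneFormat K B c₀ cL κ` with `κ ≥ κ₀`, `K ≥ K₀` on an even block torus `L₀ ≤ L' ≤ M` has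
  `Z ≠ 0` and slice order `≥ 1/2` (`EngineConclusion`);
* child 2 `BirFormatMembershipTransfer` (= 14846′, MEMBERSHIP ∧ TRANSFER about `hubbardTorus` alone):
  for some `δ ∈ (0,1/2)` and class data `(B, c₀, cL)`, EVERY triple of engine thresholds `(κ₀, K₀, L₀)`
  admits a weak-coupling window and `cP > 0` such that for every `U` in the window, eventually in even
  `L`, frequently in `β`, some weight of the class at `κ ≥ κ₀`, `K ≥ K₀`, on an even block torus
  `L₀ ≤ L' ≤ M` — the intended witness is the cyclic Trotter weight of the slaved block pair field of
  `hubbardTorus 2 L 1 U` — has the property that ITS engine conclusion implies the canonical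
  `(N_L, S^z = 0)`-sector thermal bound `cP·L⁴ ≤ Re tr(P_S e^{-βH} Δ_d†Δ_d)/tr(P_S e^{-βH})`
  (ensemble delivery included).

`birGappedPhaseReductionR_of_formatPair : child 1 → child 2 → (body of 2R) → (body of 3) → (body of X_avg)`
— the conclusion is the BODY of `BirGappedPhaseReductionR` verbatim (materialisation rule: this module
does not import the Theses file), the two typed antecedents `h2R`, `h3` are DISCARDED (the pair replaces
the inert engine; it does not consume it), and the `β → ∞` endgame is the landed Theses-free bridge
`dWaveGroundStateAverageLRO_of_frequently_thermal`.  Pure logic; no fact is asserted (both children are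
conjecture-grade route items).  Sources for the format: Balaban1995 §1; BFKT2017 §1; KoteckyPreiss1986.
-/

noncomputable section

set_option linter.dupNamespace false

namespace Summit.HubbardSuperconductivity.HubbardSuperconductivity.Theorems

open scoped BigOperators Topology Classical MeasureTheory Matrix InnerProductSpace ComplexConjugate
open Filter Set Function MeasureTheory
open Literature.MathematicalPhysics.QuantumLattice Literature.Probability.LatticeModels

/-- **The format pair gives the TARGET (structural).**  `BirFormatEngine → BirFormatMembershipTransfer → X_avg`, the
latter spelled as its body (materialisation rule); this is the mathematical content of the split glue — the engine thresholds
`(κ₀, K₀, L₀)` produced by C1 from C2's class data `(B, c₀, cL)` are fed back into C2, whose inner implication then delivers the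
frequent-in-`β` canonical-sector thermal bound, and the landed Theses-free endgame
`dWaveGroundStateAverageLRO_of_frequently_thermal` gives the ground-state-average bound.  Registered sub-goal of
stmt-HubbardSuperconductivity-14846 (line `format-pair`).  Balaban1995 §1 (format). [folklore] -/
theorem birGappedPhaseReductionR_of_formatPair_target
    (hE : ∀ (B c₀ cL : ℝ), 0 < c₀ → 0 < cL → ∃ κ₀ K₀ : ℝ, ∃ L₀ : ℕ, ∀ (κ K : ℝ), κ₀ ≤ κ → K₀ ≤ K → ∀ (L' M : ℕ) [NeZero L'] [NeZero M], L₀ ≤ L' → L' ≤ M → Even L' → Even M → ∀ ρ : (Literature.Probability.LatticeModels.TorusSite 2 L' × ZMod M → ℝ) → ℂ, Literature.Probability.LatticeModels.BalabanStepOne.StepOneFormat K B c₀ cL κ L' M ρ → Literature.Probability.LatticeModels.BalabanStepOne.EngineConclusion L' M ρ)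
    (hM : ∃ δ ∈ Set.Ioo (0:ℝ) (1/2), ∃ (B c₀ cL : ℝ), 0 < c₀ ∧ 0 < cL ∧ ∀ (κ₀ K₀ : ℝ) (L₀ : ℕ), ∃ U₁ U₂ cP : ℝ, 0 < U₁ ∧ U₁ < U₂ ∧ 0 < cP ∧ ∀ U ∈ Set.Ioo U₁ U₂, ∃ L₁ : ℕ, ∀ (L : ℕ) [NeZero L], L₁ ≤ L → Even L → let N : ℕ := 2 * ⌊(1 - δ) * (L : ℝ) ^ 2 / 2⌋₊; let H := Literature.MathematicalPhysics.QuantumLattice.hubbardTorus 2 L 1 U; let S := Literature.MathematicalPhysics.QuantumLattice.szSector (Λ := Literature.MathematicalPhysics.QuantumLattice.FermionTorus 2 L) N 0; let PS := Literature.MathematicalPhysics.QuantumLattice.projMatrix (S.map (Literature.MathematicalPhysics.QuantumLattice.Fock.toEuclidean (ι := Literature.MathematicalPhysics.QuantumLattice.Orb (Literature.MathematicalPhysics.QuantumLattice.FermionTorus 2 L)) : Literature.MathematicalPhysics.QuantumLattice.Fock (Literature.MathematicalPhysics.QuantumLattice.Orb (Literature.MathematicalPhysics.QuantumLattice.FermionTorus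 2 L)) →ₗ[ℂ] EuclideanSpace ℂ (Finset (Literature.MathematicalPhysics.QuantumLattice.Orb (Literature.MathematicalPhysics.QuantumLattice.FermionTorus 2 L))))); ∃ᶠ β : ℝ in Filter.atTop, ∃ (κ K : ℝ), κ₀ ≤ κ ∧ K₀ ≤ K ∧ ∃ (L' M : ℕ) (_ : NeZero L') (_ : NeZero M), L₀ ≤ L' ∧ L' ≤ M ∧ Even L' ∧ Even M ∧ ∃ ρ : (Literature.Probability.LatticeModels.TorusSite 2 L' × ZMod M → ℝ) → ℂ, Literature.Probability.LatticeModels.BalabanStepOne.StepOneFormat K B c₀ cL κ L' M ρ ∧ (Literature.Probability.LatticeModels.BalabanStepOne.EngineConclusion L' M ρ → cP * (L : ℝ) ^ 4 ≤ ((PS * Matrix.gibbsWeight β H * (Matrix.conjTranspose (Literature.MathematicalPhysics.QuantumLattice.pairField Literature.MathematicalPhysics.QuantumLattice.dWaveFormFactor L) * Literature.MathematicalPhysics.QuantumLattice.pairField Literature.MathematicalPhysics.QuantumLattice.dWaveFormFactor L)).trace / (PS * Matrix.gibbsWeight β H).trace).re)) :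
    ∃ δ ∈ Set.Ioo (0:ℝ) (1/2), ∃ U₁ U₂ c : ℝ, 0 < U₁ ∧ U₁ < U₂ ∧ 0 < c ∧ ∀ U ∈ Set.Ioo U₁ U₂, ∃ L₀ : ℕ, ∀ (L : ℕ) [NeZero L], L₀ ≤ L → Even L → let N : ℕ := 2 * ⌊(1 - δ) * (L : ℝ) ^ 2 / 2⌋₊; let H := Literature.MathematicalPhysics.QuantumLattice.hubbardTorus 2 L 1 U; let S := Literature.MathematicalPhysics.QuantumLattice.szSector (Λ := Literature.MathematicalPhysics.QuantumLattice.FermionTorus 2 L) N 0; let E₀ := S ⊓ Module.End.eigenspace (Matrix.toLin' H) ((H.minEnergyOn S : ℝ) : ℂ); let P := Literature.MathematicalPhysics.QuantumLattice.projMatrix (E₀.map (Literature.MathematicalPhysics.QuantumLattice.Fock.toEuclidean (ι := Literature.MathematicalPhysics.QuantumLattice.Orb (Literature.MathematicalPhysics.QuantumLattice.FermionTorus 2 L)) : Literature.MathematicalPhysics.QuantumLattice.Fock (Literature.MathematicalPhysics.QuantumLattice.Orb (Literature.MathematicalPhysics.QuantumLattice.FermionTorus 2 L)) →ₗ[ℂ]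 EuclideanSpace ℂ (Finset (Literature.MathematicalPhysics.QuantumLattice.Orb (Literature.MathematicalPhysics.QuantumLattice.FermionTorus 2 L))))); c * (L : ℝ) ^ 4 * P.trace.re ≤ (P * (Matrix.conjTranspose (Literature.MathematicalPhysics.QuantumLattice.pairField Literature.MathematicalPhysics.QuantumLattice.dWaveFormFactor L) * Literature.MathematicalPhysics.QuantumLattice.pairField Literature.MathematicalPhysics.QuantumLattice.dWaveFormFactor L)).trace.re := by
  refine dWaveGroundStateAverageLRO_of_frequently_thermal ?_
  obtain ⟨δ, hδ, B, c₀, cL, hc₀, hcL, hW⟩ := hM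
  obtain ⟨κ₀, K₀, L₀, hK⟩ := hE B c₀ cL hc₀ hcL
  obtain ⟨U₁, U₂, cP, hU₁, hU₁₂, hcP, hU⟩ := hW κ₀ K₀ L₀
  refine ⟨δ, hδ, U₁, U₂, cP, hU₁, hU₁₂, hcP, fun U hUU => ?_⟩
  obtain ⟨L₁, hL⟩ := hU U hUU
  refine ⟨L₁, fun L _ hL₁ hLe => ?_⟩
  have key := hL L hL₁ hLe
  dsimp only at key ⊢
  refine key.mono ?_
  rintro β ⟨κ, K, hκ, hKK, L', M, _, _, hL₀, hLM, hL'e, hMe, ρ, hρ, himp⟩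
  exact himp (hK κ K hκ hKK L' M hL₀ hLM hL'e hMe ρ hρ)

/-- **The format pair closes crux 4R (structural).**  `BirFormatEngine → BirFormatMembershipTransfer →
BirGappedPhaseReductionR`, the latter spelled as its body `(2R) → (3) → (X_avg)`; `h2R`, `h3` unused.
Balaban1995 §1 (format); the endgame is `dWaveGroundStateAverageLRO_of_frequently_thermal`. [folklore] -/
theorem birGappedPhaseReductionR_of_formatPair
    (hE : ∀ (B c₀ cL : ℝ), 0 < c₀ → 0 < cL → ∃ κ₀ K₀ : ℝ, ∃ L₀ : ℕ, ∀ (κ K : ℝ), κ₀ ≤ κ → K₀ ≤ K → ∀ (L' M : ℕ) [NeZero L'] [NeZero M], L₀ ≤ L' → L' ≤ M → Even L' → Even M → ∀ ρ : (Literature.Probability.LatticeModels.TorusSite 2 L' × ZMod M → ℝ) → ℂ, Literature.Probability.LatticeModels.BalabanStepOne.StepOneFormat K B c₀ cL κ L' M ρ → Literature.Probability.LatticeModels.BalabanStepOne.EngineConclusion L' M ρ)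
    (hM : ∃ δ ∈ Set.Ioo (0:ℝ) (1/2), ∃ (B c₀ cL : ℝ), 0 < c₀ ∧ 0 < cL ∧ ∀ (κ₀ K₀ : ℝ) (L₀ : ℕ), ∃ U₁ U₂ cP : ℝ, 0 < U₁ ∧ U₁ < U₂ ∧ 0 < cP ∧ ∀ U ∈ Set.Ioo U₁ U₂, ∃ L₁ : ℕ, ∀ (L : ℕ) [NeZero L], L₁ ≤ L → Even L → let N : ℕ := 2 * ⌊(1 - δ) * (L : ℝ) ^ 2 / 2⌋₊; let H := Literature.MathematicalPhysics.QuantumLattice.hubbardTorus 2 L 1 U; let S := Literature.MathematicalPhysics.QuantumLattice.szSector (Λ := Literature.MathematicalPhysics.QuantumLattice.FermionTorus 2 L) N 0; let PS := Literature.MathematicalPhysics.QuantumLattice.projMatrix (S.map (Literature.MathematicalPhysics.QuantumLattice.Fock.toEuclidean (ι := Literature.MathematicalPhysics.QuantumLattice.Orb (Literature.MathematicalPhysics.QuantumLattice.FermionTorus 2 L)) : Literature.MathematicalPhysics.QuantumLattice.Fock (Literature.MathematicalPhysics.QuantumLattice.Orb (Literature.MathematicalPhysics.QuantumLattice.FermionTorus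 2 L)) →ₗ[ℂ] EuclideanSpace ℂ (Finset (Literature.MathematicalPhysics.QuantumLattice.Orb (Literature.MathematicalPhysics.QuantumLattice.FermionTorus 2 L))))); ∃ᶠ β : ℝ in Filter.atTop, ∃ (κ K : ℝ), κ₀ ≤ κ ∧ K₀ ≤ K ∧ ∃ (L' M : ℕ) (_ : NeZero L') (_ : NeZero M), L₀ ≤ L' ∧ L' ≤ M ∧ Even L' ∧ Even M ∧ ∃ ρ : (Literature.Probability.LatticeModels.TorusSite 2 L' × ZMod M → ℝ) → ℂ, Literature.Probability.LatticeModels.BalabanStepOne.StepOneFormat K B c₀ cL κ L' M ρ ∧ (Literature.Probability.LatticeModels.BalabanStepOne.EngineConclusion L' M ρ → cP * (L : ℝ) ^ 4 ≤ ((PS * Matrix.gibbsWeight β H * (Matrix.conjTranspose (Literature.MathematicalPhysics.QuantumLattice.pairField Literature.MathematicalPhysics.QuantumLattice.dWaveFormFactor L) * Literature.MathematicalPhysics.QuantumLattice.pairField Literature.MathematicalPhysics.QuantumLattice.dWaveFormFactor L)).trace / (PS * Matrix.gibbsWeight β H).trace).re)) :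
    (∀ (r : ℕ) (B c₀ : ℝ), 2 ≤ r → 0 < c₀ → ∃ K₀ : ℝ, ∃ L₀ : ℕ, ∀ K : ℝ, K₀ ≤ K → ∀ c : ((Fin r × Fin r × Fin r) → ℤ) →₀ ℂ, (∀ n ∈ c.support, ∑ w, n w = 0) → c.sum (fun _ a => a) = 0 → c.sum (fun n a => ‖a‖ * Real.exp (∑ w, |(n w : ℝ)|)) ≤ B → (∀ φ : (Fin r × Fin r × Fin r) → ℝ, c₀ * ∑ w, ∑ w', (1 - Real.cos (φ w - φ w')) ≤ ((fun (φ : (Fin r × Fin r × Fin r) → ℝ) => c.sum (fun n a => a * Complex.exp (Complex.I * ((∑ w, (n w : ℝ) * φ w : ℝ) : ℂ)))) φ).re) → (∀ n : (Fin r × Fin r × Fin r) → ℤ, c (fun w => n (w.1, w.2.1, Fin.rev w.2.2)) = (starRingEnd ℂ) (c (-n))) → (∀ n : (Fin r × Fin r × Fin r) → ℤ, c (fun w => n (Fin.rev w.1, Fin.rev w.2.1, w.2.2)) = c n) → ∀ (L M : ℕ) [NeZero L] [NeZero M], L₀ ≤ L → L ≤ M → Even L → Even M → let sh : (Literature.Probability.LatticeModels.TorusSite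 2 L × ZMod M) → (Fin r × Fin r × Fin r) → (Literature.Probability.LatticeModels.TorusSite 2 L × ZMod M) := fun s w => (s.1 + ![((w.1 : ℕ) : ZMod L), ((w.2.1 : ℕ) : ZMod L)], s.2 + ((w.2.2 : ℕ) : ZMod M)); let F : ((Fin r × Fin r × Fin r) → ℝ) → ℂ := fun (φ : (Fin r × Fin r × Fin r) → ℝ) => c.sum (fun n a => a * Complex.exp (Complex.I * ((∑ w, (n w : ℝ) * φ w : ℝ) : ℂ))); let A : ((Literature.Probability.LatticeModels.TorusSite 2 L × ZMod M) → ℝ) → ℂ := fun θ => (K : ℂ) * ∑ s : (Literature.Probability.LatticeModels.TorusSite 2 L × ZMod M), F (fun w => θ (sh s w)); let cube : Set ((Literature.Probability.LatticeModels.TorusSite 2 L × ZMod M) → ℝ) := Set.pi Set.univ (fun _ => Set.Icc (0:ℝ) (2 * Real.pi)); let Z : ℂ := MeasureTheory.integral (MeasureTheory.volume.restrict cube) (fun θ => Complex.exp (-(A θ))); let O : ((Literature.Probability.LatticeModels.TorusSite 2 L × ZMod M) → ℝ) → ℝ := fun θ => ‖∑ x : Literature.Probability.LatticeModels.TorusSite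 2 L, Complex.exp (Complex.I * (θ (x, 0) : ℂ))‖ ^ 2 / (L : ℝ) ^ 4; Z ≠ 0 ∧ (1/2 : ℝ) ≤ ((MeasureTheory.integral (MeasureTheory.volume.restrict cube) (fun θ => (O θ : ℂ) * Complex.exp (-(A θ)))) / Z).re) →
    (∀ (μ Δ₁ Δ₂ : ℝ), μ ∈ Set.Ioo (-4:ℝ) 4 → Δ₁ ≠ 0 → Δ₂ ≠ 0 → ∃ c₀ : ℝ, 0 < c₀ ∧ ∃ L₀ : ℕ, ∀ (L : ℕ) [NeZero L], L₀ ≤ L → let nnx : Literature.Probability.LatticeModels.TorusSite 2 L → Literature.Probability.LatticeModels.TorusSite 2 L → Prop := fun x y => y = x + ![1, 0] ∨ y = x + ![-1, 0]; let nny : Literature.Probability.LatticeModels.TorusSite 2 L → Literature.Probability.LatticeModels.TorusSite 2 L → Prop := fun x y => y = x + ![0, 1] ∨ y = x + ![0, -1]; let dg1 : Literature.Probability.LatticeModels.TorusSite 2 L → Literature.Probability.LatticeModels.TorusSite 2 L → Prop := fun x y => y = x + ![1, 1] ∨ y = x + ![-1, -1]; let dg2 : Literature.Probability.LatticeModels.TorusSite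 2 L → Literature.Probability.LatticeModels.TorusSite 2 L → Prop := fun x y => y = x + ![1, -1] ∨ y = x + ![-1, 1]; let h : Matrix (Literature.Probability.LatticeModels.TorusSite 2 L) (Literature.Probability.LatticeModels.TorusSite 2 L) ℂ := fun x y => -(if nnx x y ∨ nny x y then (1 : ℂ) else 0) - (if x = y then (μ : ℂ) else 0); let D : (Literature.Probability.LatticeModels.TorusSite 2 L → ℝ) → Matrix (Literature.Probability.LatticeModels.TorusSite 2 L) (Literature.Probability.LatticeModels.TorusSite 2 L) ℂ := fun θ x y => ((Δ₁ : ℂ) * ((if nnx x y then (1 : ℂ) else 0) - (if nny x y then (1 : ℂ) else 0)) + Complex.I * (Δ₂ : ℂ) * ((if dg1 x y then (1 : ℂ) else 0) - (if dg2 x y then (1 : ℂ) else 0))) * (Complex.exp (Complex.I * (θ x : ℂ)) + Complex.exp (Complex.I * (θ y : ℂ))) / 2; let Hb : (Literature.Probability.LatticeModels.TorusSite 2 L → ℝ) → Matrix (Literature.Probability.LatticeModels.TorusSite 2 L ⊕ Literature.Probability.LatticeModels.TorusSite 2 L) (Literature.Probability.LatticeModels.TorusSite 2 L ⊕ Literature.Probability.LatticeModels.TorusSite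 2 L) ℂ := fun θ => Matrix.fromBlocks h (D θ) (Matrix.conjTranspose (D θ)) (-h); ∀ θ : Literature.Probability.LatticeModels.TorusSite 2 L → ℝ, ∀ (hθ : (Hb θ).IsHermitian) (h0 : (Hb (fun _ => 0)).IsHermitian), c₀ * ∑ x : Literature.Probability.LatticeModels.TorusSite 2 L, ∑ y : Literature.Probability.LatticeModels.TorusSite 2 L, (if nnx x y ∨ nny x y then (1 - Real.cos (θ x - θ y)) else 0) ≤ ∑ i, |h0.eigenvalues i| - ∑ i, |hθ.eigenvalues i|) →
    (∃ δ ∈ Set.Ioo (0:ℝ) (1/2), ∃ U₁ U₂ c : ℝ, 0 < U₁ ∧ U₁ < U₂ ∧ 0 < c ∧ ∀ U ∈ Set.Ioo U₁ U₂, ∃ L₀ : ℕ, ∀ (L : ℕ) [NeZero L], L₀ ≤ L → Even L → let N : ℕ := 2 * ⌊(1 - δ) * (L : ℝ) ^ 2 / 2⌋₊; let H := Literature.MathematicalPhysics.QuantumLattice.hubbardTorus 2 L 1 U; let S := Literature.MathematicalPhysics.QuantumLattice.szSector (Λ := Literature.MathematicalPhysics.QuantumLattice.FermionTorus 2 L)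 N 0; let E₀ := S ⊓ Module.End.eigenspace (Matrix.toLin' H) ((H.minEnergyOn S : ℝ) : ℂ); let P := Literature.MathematicalPhysics.QuantumLattice.projMatrix (E₀.map (Literature.MathematicalPhysics.QuantumLattice.Fock.toEuclidean (ι := Literature.MathematicalPhysics.QuantumLattice.Orb (Literature.MathematicalPhysics.QuantumLattice.FermionTorus 2 L)) : Literature.MathematicalPhysics.QuantumLattice.Fock (Literature.MathematicalPhysics.QuantumLattice.Orb (Literature.MathematicalPhysics.QuantumLattice.FermionTorus 2 L)) →ₗ[ℂ] EuclideanSpace ℂ (Finset (Literature.MathematicalPhysics.QuantumLattice.Orb (Literature.MathematicalPhysics.QuantumLattice.FermionTorus 2 L))))); c * (L : ℝ) ^ 4 * P.trace.re ≤ (P * (Matrix.conjTranspose (Literature.MathematicalPhysics.QuantumLattice.pairField Literature.MathematicalPhysics.QuantumLattice.dWaveFormFactor L) * Literature.MathematicalPhysics.QuantumLattice.pairField Literature.MathematicalPhysics.QuantumLattice.dWaveFormFactor L)).trace.re) :=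
  fun _ _ => birGappedPhaseReductionR_of_formatPair_target hE hM

end Summit.HubbardSuperconductivity.HubbardSuperconductivity.Theorems

end
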